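import Summits.ABC.IUTFork.Conditional.AbcOfSGenuineMShrink1
import HarnessLib

/-!
# Branch C — KERNEL LINK between the M-level S_H line (v9M/v10M) and the DOWNSTREAM certificate (`abc_of_cor312Statement_genuineM`, p443000):
# per datum, S_H at the pinned reading IMPLIES the typed Cor. 3.12 `Statement` of the same genuine M-setting

C scoreboard (INTAKE, abc-iut-C-cert-3 gen 2). PROOF-ONLY (no `def`, no new `Prop`; nothing re-typed). The scoreboard and STATUS
2026-08-26T11:53:16Z assert that the downstream certificate `Conditional.abc_of_cor312Statement_genuineM` (hypotheses: [C312] `hst` = the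
typed `Cor312.Setting.Statement` of abc-iut-s2-p8's `settingPrVolSharpM T.D …` at admissible data, + `hreg`) is STRONGER than the M-line
apex `Conditional.abc_of_SH_v10M` (abc-iut-s2-p12 p442072; hypotheses: [S_H] `hSH` pinned, + `hreg`) at equal explicit count. This file
puts that comparison in the kernel, per datum: `GenuineMStatement.statement_of_SH` derives `hst`'s datum clause from `hSH`'s datum clause
— abc-iut-w5-d068's `Cor312Vol.statement_of_pilotKummerCompatHull` (S_H under the q-pin gives the printed `Statement`, given `BridgeHyps`)
at abc-iut-s2-p8's THEOREM `bridgeHyps_settingPrVolSharpM_of_ideles` (p438078; side conditions abc-iut-w5-d033 p436273) and the q-pin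
`fun _ _ => rfl` of the pinned reading `ρ := fun _ => P.qRegion`. Hence, pointwise under the admissibility guards,
`abc_of_SH_v10M … hSH hreg = abc_of_cor312Statement_genuineM … (fun P hP l hl h5 hc h2 h5' h6 T => statement_of_SH … (hSH P hP l hl h5 hc h2 h5' h6 T)) hreg`
(not restated as a declaration: the left side IS the landed p442072). The converse hst ⟹ hSH is NOT claimed (S_H is a per-packet SET
inclusion, strictly stronger than the number-level `Statement`). The second theorem re-expresses the obtained `Statement` on the q-side in
abc-iut-w5-d244's NUMBER form `↑(−absLogq T.D) ≤ −|log Θ|(setting)` through v9M's provenance theorem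
`GenuineMShrink.isSettingOf_settingPrVolSharpM` (p441598 = p439939 ∘ p437121).

HONEST FRAMING: locates / conditionally verifies; nothing here asserts that abc is proved or refuted or that [IUTchIII] Cor. 3.12 holds or
fails; no side taken on any author; S_H and the typed `Statement` are assumption labels; typed ≠ proved; instantiated ≠ endorsed.
[claim: Mochizuki2012, status: disputed] [cite: Mochizuki2012, IUTchIII Cor. 3.12 p. 173–174, Step (xi-d) p. 183, (xi-f) p. 184]
-/

noncomputable section

open Set Function NumberField IsDedekindDomain

namespace Summit.ABC.IUTFork.Conditional

open Thm311 Thm311.Real Cor312 Cor312Vol Cor312Prov Literature.IUT.LogThetaLattice Literature.IUT.LogVolume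
  Literature.IUT.HodgeTheaters Literature.IUT.LogVolume.ThetaData Literature.NumberTheory.NumberFields

section PerDatum

variable {F K Fbar : Type} [Field F] [NumberField F] [Field K] [NumberField K] [Algebra F K] [Field Fbar]
  [Algebra F Fbar] [Algebra K Fbar] {E : WeierstrassCurve F} [E.IsElliptic] {l : ℕ} {Pb : BadPlacePredicates K}

variable (D : InitialThetaData F K Fbar E l Pb) {I : ThetaVolumeInput (fieldOfModuli E) K}
  (M : Type) [Field M] [NumberField M]
  (archPk : ∀ (j : (thetaIndexOfInitial D).Label) (vQ : (thetaIndexOfInitial D).VQ),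
    Set ((logShellsOfInitialDH D (analyticLogvVal K)).Packet j vQ))
  (archSub : ∀ (j : (thetaIndexOfInitial D).Label) (v : (thetaIndexOfInitial D).V),
    Set ((logShellsOfInitialDH D (analyticLogvVal K)).Packet j ((thetaIndexOfInitial D).over v)))
  (Ψ : ℤ → ∀ v : (thetaIndexOfInitial D).V, v ∈ (thetaIndexOfInitial D).Vbad →
    Set ((logShellsOfInitialDH D (analyticLogvVal K)).StarPacket v))
  (act : ℤ → ∀ v : (thetaIndexOfInitial D).V, v ∈ (thetaIndexOfInitial D).Vbad →
    (logShellsOfInitialDH D (analyticLogvVal K)).StarPacket v →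
      Module.End ℚ ((logShellsOfInitialDH D (analyticLogvVal K)).StarPacket v))
  (Mmod : ℤ → ∀ j : (thetaIndexOfInitial D).LabelStar, Set ((logShellsOfInitialDH D (analyticLogvVal K)).GlobalPacket j.1))
  (region : ℤ → ∀ j : (thetaIndexOfInitial D).LabelStar, FinDivisor M → ∀ vQ : (thetaIndexOfInitial D).VQ,
    Set ((logShellsOfInitialDH D (analyticLogvVal K)).Packet j.1 vQ))
  (frobAdm : ℤ → ℤ → ∀ (j : (thetaIndexOfInitial D).Label) (vQ : (thetaIndexOfInitial D).VQ),
    Set ((logShellsOfInitialDH D (analyticLogvVal K)).Packet j vQ) → Prop)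
  (frobLogvol : ℤ → ℤ → ∀ (j : (thetaIndexOfInitial D).Label) (vQ : (thetaIndexOfInitial D).VQ),
    Set ((logShellsOfInitialDH D (analyticLogvVal K)).Packet j vQ) → ℝ)
  (frobΨ : ℤ → ℤ → ∀ v : (thetaIndexOfInitial D).V, v ∈ (thetaIndexOfInitial D).Vbad →
    Set ((logShellsOfInitialDH D (analyticLogvVal K)).StarPacket v))
  (frobMmod : ℤ → ℤ → ∀ j : (thetaIndexOfInitial D).LabelStar, Set ((logShellsOfInitialDH D (analyticLogvVal K)).GlobalPacket j.1))
  (unitImage : ℤ → ℤ → ℕ → ∀ (j : (thetaIndexOfInitial D).Label) (vQ : (thetaIndexOfInitial D).VQ),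
    Set ((logShellsOfInitialDH D (analyticLogvVal K)).Packet j vQ))
  (ballImage : ℤ → ℤ → ∀ (j : (thetaIndexOfInitial D).Label) (vQ : (thetaIndexOfInitial D).VQ),
    Set ((logShellsOfInitialDH D (analyticLogvVal K)).Packet j vQ))
  (thetaDiv : ℤ → ℤ → LgpDivisor M (thetaIndexOfInitial D).lstar)
  (n : ℤ) {HT : Type} {LogLink : HT → HT → Type} {IsFull : ∀ {s t : HT}, LogLink s t → Prop}
  (lat : LGPGaussianLogThetaLattice LogLink IsFull)
  {Frd : Type} {IsoF : Frd → Frd → Type} {Ob : Frd → Type} {realify : Frd → Frd} {Strip : Type}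
  {IsoS : Strip → Strip → Type} {Mv : ∀ v : (thetaIndexOfInitial D).V, v ∈ (thetaIndexOfInitial D).Vbad → Type}
  [∀ v h, Monoid (Mv v h)]
  (sig : GlobalLGPFrobenioidSignature (thetaIndexOfInitial D).lstar (thetaIndexOfInitial D).V
    (· ∈ (thetaIndexOfInitial D).Vbad) Frd IsoF Ob realify Strip IsoS Mv)
  (split : SplittingMonoids Mv) {ObΔ : Type} {N : ∀ v : (thetaIndexOfInitial D).V, v ∈ (thetaIndexOfInitial D).Vbad → Type}
  [∀ v h, Monoid (N v h)] (qData : QPilotData ObΔ N)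
  (qK : ∀ v : (thetaIndexOfInitial D).V, v ∈ (thetaIndexOfInitial D).Vbad →
    Set ((logShellsOfInitialDH D (analyticLogvVal K)).StarPacket v))

/-! ## Per datum: S_H (pinned reading) ⟹ the typed Cor. 3.12 `Statement` at the summand-route M-level genuine sharp setting -/

/-- **S_H ⟹ typed Cor. 3.12 `Statement`, per datum, at the summand-route M-level genuine sharp setting of the datum's OWN ideles**
(q-region PINNED, free `qK`): the datum clause of v9M/v10M's `hSH` gives the datum clause of the downstream certificate's `hst`
(`abc_of_cor312Statement_genuineM`, p443000) — abc-iut-w5-d068's `statement_of_pilotKummerCompatHull` at abc-iut-s2-p8's `BridgeHyps`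
THEOREM (p438078) and the q-pin `rfl`. No side taken on [IUTchIII] Cor. 3.12. [claim: Mochizuki2012, status: disputed] -/
theorem GenuineMStatement.statement_of_SH (hI : ThetaData.IsVolumeInputOf D I)
    (hSH : Cor312Vol.PilotKummerCompatHull
      (LatticeSituation.ofShells (logShellsOfInitialDH D (analyticLogvVal K)) M archPk archSub
        (summandPiecesPrM D (logvAnalyticVal_analyticLogvVal (K := K))).Adm (summandPiecesPrM D (logvAnalyticVal_analyticLogvVal (K := K))).logvol Ψ act Mmod region frobAdm frobLogvol
        frobΨ frobMmod unitImage ballImage thetaDiv)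
      (settingPrVolSharpM D (logvAnalyticVal_analyticLogvVal (K := K)) (tOfIdeleData D (ideleDataOf D hI))
        (fun u x => tqM D (ratChar u) u (natCast_ratChar_mem u) (ideleDataOf D hI) x) M archPk archSub Ψ act Mmod region n lat sig split qData
        (fun u x => tqM_ne_zero D (ratChar u) u (natCast_ratChar_mem u) (ideleDataOf D hI) x)
        (GenuineM.finite_ratPlaces_under_S D).toFinset
        (fun u x hu => norm_tqM_eq_one_of_not_mem D (ratChar u) u (natCast_ratChar_mem u) (ideleDataOf D hI) x
          fun hx => hu ((Set.Finite.mem_toFinset _).mpr ⟨x, hx⟩)))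
      (fun _ => Cor312.Setting.qRegion
        (settingPrVolSharpM D (logvAnalyticVal_analyticLogvVal (K := K)) (tOfIdeleData D (ideleDataOf D hI))
        (fun u x => tqM D (ratChar u) u (natCast_ratChar_mem u) (ideleDataOf D hI) x) M archPk archSub Ψ act Mmod region n lat sig split qData
        (fun u x => tqM_ne_zero D (ratChar u) u (natCast_ratChar_mem u) (ideleDataOf D hI) x)
        (GenuineM.finite_ratPlaces_under_S D).toFinset
        (fun u x hu => norm_tqM_eq_one_of_not_mem D (ratChar u) u (natCast_ratChar_mem u) (ideleDataOf D hI) x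
          fun hx => hu ((Set.Finite.mem_toFinset _).mpr ⟨x, hx⟩)))) qK) :
    (settingPrVolSharpM D (logvAnalyticVal_analyticLogvVal (K := K)) (tOfIdeleData D (ideleDataOf D hI))
        (fun u x => tqM D (ratChar u) u (natCast_ratChar_mem u) (ideleDataOf D hI) x) M archPk archSub Ψ act Mmod region n lat sig split
        qData (fun u x => tqM_ne_zero D (ratChar u) u (natCast_ratChar_mem u) (ideleDataOf D hI) x)
        (GenuineM.finite_ratPlaces_under_S D).toFinset
        (fun u x hu => norm_tqM_eq_one_of_not_mem D (ratChar u) u (natCast_ratChar_mem u) (ideleDataOf D hI) x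
          fun hx => hu ((Set.Finite.mem_toFinset _).mpr ⟨x, hx⟩))).Statement :=
  Cor312Vol.statement_of_pilotKummerCompatHull
    (LatticeSituation.ofShells (logShellsOfInitialDH D (analyticLogvVal K)) M archPk archSub
      (summandPiecesPrM D (logvAnalyticVal_analyticLogvVal (K := K))).Adm (summandPiecesPrM D (logvAnalyticVal_analyticLogvVal (K := K))).logvol Ψ act Mmod region frobAdm frobLogvol
      frobΨ frobMmod unitImage ballImage thetaDiv)
    (settingPrVolSharpM D (logvAnalyticVal_analyticLogvVal (K := K)) (tOfIdeleData D (ideleDataOf D hI))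
      (fun u x => tqM D (ratChar u) u (natCast_ratChar_mem u) (ideleDataOf D hI) x) M archPk archSub Ψ act Mmod region n lat sig split
      qData (fun u x => tqM_ne_zero D (ratChar u) u (natCast_ratChar_mem u) (ideleDataOf D hI) x)
      (GenuineM.finite_ratPlaces_under_S D).toFinset
      (fun u x hu => norm_tqM_eq_one_of_not_mem D (ratChar u) u (natCast_ratChar_mem u) (ideleDataOf D hI) x
        fun hx => hu ((Set.Finite.mem_toFinset _).mpr ⟨x, hx⟩)))
    (fun _ => Cor312.Setting.qRegion
      (settingPrVolSharpM D (logvAnalyticVal_analyticLogvVal (K := K)) (tOfIdeleData D (ideleDataOf D hI))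
      (fun u x => tqM D (ratChar u) u (natCast_ratChar_mem u) (ideleDataOf D hI) x) M archPk archSub Ψ act Mmod region n lat sig split
      qData (fun u x => tqM_ne_zero D (ratChar u) u (natCast_ratChar_mem u) (ideleDataOf D hI) x)
      (GenuineM.finite_ratPlaces_under_S D).toFinset
      (fun u x hu => norm_tqM_eq_one_of_not_mem D (ratChar u) u (natCast_ratChar_mem u) (ideleDataOf D hI) x
        fun hx => hu ((Set.Finite.mem_toFinset _).mpr ⟨x, hx⟩)))) qK
    (bridgeHyps_settingPrVolSharpM_of_ideles D (logvAnalyticVal_analyticLogvVal (K := K)) (tOfIdeleData D (ideleDataOf D hI))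
      (fun u x => tqM D (ratChar u) u (natCast_ratChar_mem u) (ideleDataOf D hI) x) M archPk archSub Ψ act Mmod region n lat sig split qData
      (fun u x => tqM_ne_zero D (ratChar u) u (natCast_ratChar_mem u) (ideleDataOf D hI) x)
      (GenuineM.finite_ratPlaces_under_S D).toFinset
      (fun u x hu => norm_tqM_eq_one_of_not_mem D (ratChar u) u (natCast_ratChar_mem u) (ideleDataOf D hI) x
          fun hx => hu ((Set.Finite.mem_toFinset _).mpr ⟨x, hx⟩))
      (fun u i x => tThetaM_ne_zero D (ratChar u) u (natCast_ratChar_mem u) (ideleDataOf D hI) i x)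
      (GenuineM.finite_ratPlaces_under_S D).toFinset
      (fun u i x hu => norm_tThetaM_eq_one_of_not_mem D (ratChar u) u (natCast_ratChar_mem u) (ideleDataOf D hI) i x
        fun hx => hu ((Set.Finite.mem_toFinset _).mpr ⟨x, hx⟩)))
    (fun _ _ => rfl) hSH

/-- **… in abc-iut-w5-d244's NUMBER form on the q-side**: from S_H (pinned) at the genuine M-setting, `↑(−absLogq T.D) ≤ −|log Θ|(setting)`
— the `Statement` above with its q-side rewritten by v9M's provenance theorem `GenuineMShrink.isSettingOf_settingPrVolSharpM`
(`IsSettingOf.negLogQ_eq`). The Θ-side step to `I.Cor312Of` is abc-iut-s2-p8's p440655 (taken in `GenuineMShrink2.cor312Of_of_SH`, p442072,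
not restated). [claim: Mochizuki2012, status: disputed] -/
theorem GenuineMStatement.neg_absLogq_le_negLogTheta_of_SH (hI : ThetaData.IsVolumeInputOf D I)
    (hSH : Cor312Vol.PilotKummerCompatHull
      (LatticeSituation.ofShells (logShellsOfInitialDH D (analyticLogvVal K)) M archPk archSub
        (summandPiecesPrM D (logvAnalyticVal_analyticLogvVal (K := K))).Adm (summandPiecesPrM D (logvAnalyticVal_analyticLogvVal (K := K))).logvol Ψ act Mmod region frobAdm frobLogvol
        frobΨ frobMmod unitImage ballImage thetaDiv)
      (settingPrVolSharpM D (logvAnalyticVal_analyticLogvVal (K := K)) (tOfIdeleData D (ideleDataOf D hI))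
        (fun u x => tqM D (ratChar u) u (natCast_ratChar_mem u) (ideleDataOf D hI) x) M archPk archSub Ψ act Mmod region n lat sig split qData
        (fun u x => tqM_ne_zero D (ratChar u) u (natCast_ratChar_mem u) (ideleDataOf D hI) x)
        (GenuineM.finite_ratPlaces_under_S D).toFinset
        (fun u x hu => norm_tqM_eq_one_of_not_mem D (ratChar u) u (natCast_ratChar_mem u) (ideleDataOf D hI) x
          fun hx => hu ((Set.Finite.mem_toFinset _).mpr ⟨x, hx⟩)))
      (fun _ => Cor312.Setting.qRegion
        (settingPrVolSharpM D (logvAnalyticVal_analyticLogvVal (K := K)) (tOfIdeleData D (ideleDataOf D hI))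
        (fun u x => tqM D (ratChar u) u (natCast_ratChar_mem u) (ideleDataOf D hI) x) M archPk archSub Ψ act Mmod region n lat sig split qData
        (fun u x => tqM_ne_zero D (ratChar u) u (natCast_ratChar_mem u) (ideleDataOf D hI) x)
        (GenuineM.finite_ratPlaces_under_S D).toFinset
        (fun u x hu => norm_tqM_eq_one_of_not_mem D (ratChar u) u (natCast_ratChar_mem u) (ideleDataOf D hI) x
          fun hx => hu ((Set.Finite.mem_toFinset _).mpr ⟨x, hx⟩)))) qK) :
    (((-Cor312Prov.absLogq D : ℝ) : WithTop ℝ)) ≤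
      (settingPrVolSharpM D (logvAnalyticVal_analyticLogvVal (K := K)) (tOfIdeleData D (ideleDataOf D hI))
        (fun u x => tqM D (ratChar u) u (natCast_ratChar_mem u) (ideleDataOf D hI) x) M archPk archSub Ψ act Mmod region n lat sig split
        qData (fun u x => tqM_ne_zero D (ratChar u) u (natCast_ratChar_mem u) (ideleDataOf D hI) x)
        (GenuineM.finite_ratPlaces_under_S D).toFinset
        (fun u x hu => norm_tqM_eq_one_of_not_mem D (ratChar u) u (natCast_ratChar_mem u) (ideleDataOf D hI) x
          fun hx => hu ((Set.Finite.mem_toFinset _).mpr ⟨x, hx⟩))).negLogTheta := by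
  obtain ⟨-, hle⟩ := GenuineMStatement.statement_of_SH D M archPk archSub Ψ act Mmod region frobAdm frobLogvol frobΨ frobMmod unitImage
    ballImage thetaDiv n lat sig split qData qK hI hSH
  rw [(GenuineMShrink.isSettingOf_settingPrVolSharpM D M archPk archSub Ψ act Mmod region n lat sig split qData hI).negLogQ_eq] at hle
  exact hle

end PerDatum

end Summit.ABC.IUTFork.Conditional

end
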